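import Mathlib
import Literature.Analysis.FluidPDE.KatoL3Uniqueness
import Summits.NavierStokesRegularity.NavierStokesRegularity.Theorems.L3TimeExponentPincerCritModulusNoSwirlReduction
import Summits.NavierStokesRegularity.NavierStokesRegularity.Theorems.L3TimeExponentPincerSFL3
import HarnessLib.Audit
import HarnessLib

/-!
# L3TimeExponentPincer — the (J) reduction from the node `(SFL³)`: `SFL3 → CritSmoothingNoSwirlB`

Support kernel for the crux `L3CascadeJaw` (item stmt-NavierStokesRegularity-19499) of route
`L3TimeExponentPincer` (planner nsreg-p2's ROUND-12 §2b / Addendum A): the one-line wrappers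
connecting the assembled reduction `…CritModulusNoSwirlReduction.critSmoothingNoSwirlB_of_regularity`
(hypothesis spelled out) with the `@[conjecture]` nodes of `…Theorems.L3TimeExponentPincerSFL3`,
and the consequences in the route's currencies:

* `critSmoothingNoSwirlB_of_sfl3` — **(SFL³) ⇒ CS_ns^B** (the (J) step by name);
* `critSmoothingNoSwirlB_of_sfl3Mild` — **(SFL³-mild) ⇒ CS_ns^B** (with `sfl3_of_sfl3Mild`);
* `sfl3Mild_of_hasGlobalKatoSolution` — the node `SFL3Mild` from its `HasGlobalKatoSolution`
  phrasing (`T_max(u₀) = ∞` in the vocabulary of `MildSolutions.lean`; gluing of Kato solutions by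
  the proved uniqueness `kato_unique_holds`), so that a proof of «swirl-free axisymmetric `L³` data
  have `T_max = ∞`» in either vocabulary closes the chain;
* `lpTime_three_le_noSwirl_of_sfl3` — **(SFL³) ⇒ the velocity-indexed swirl-free `L³`-in-time
  jaw for every `q ≥ 0`** (finite for `q < 6`), by `lpTime_three_le_noSwirl_of_critSmoothingNoSwirl`.

WHAT THIS IS NOT: not NS regularity or blow-up — implications between OPEN swirl-free statements
(`SFL3`, `SFL3Mild`, `CritSmoothingNoSwirlB`: none asserted or refuted); the crux `L3CascadeJaw`
(full class) is untouched; no crux claim.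
-/

noncomputable section

open MeasureTheory Set Function Filter Topology TopologicalSpace Metric
open scoped ENNReal NNReal

namespace Summit.NavierStokesRegularity.NavierStokesRegularity.Theorems.L3TimeExponentPincerCritModulusNoSwirlReductionSFL3

open Literature.Analysis.FluidPDE
open Summit.NavierStokesRegularity.NavierStokesRegularity.Theorems.L3TimeExponentPincerQuantJaw
open Summit.NavierStokesRegularity.NavierStokesRegularity.Theorems.L3TimeExponentPincerCritModulus
open Summit.NavierStokesRegularity.NavierStokesRegularity.Theorems.L3TimeExponentPincerCritModulusNoSwirlReduction
open Summit.NavierStokesRegularity.NavierStokesRegularity.Theorems.L3TimeExponentPincerSFL3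

/-- **(J): `(SFL³) ⇒ CritSmoothingNoSwirlB`** — regularity at positive times of swirl-free
axisymmetric local Leray solutions with `L³` data implies the existence of a velocity-indexed
critical smoothing modulus in the swirl-free Tao class (Jia–Šverák compactness + stability of
regularity + receding-axis lemma; assembled in `critSmoothingNoSwirlB_of_regularity`). -/
theorem critSmoothingNoSwirlB_of_sfl3 (h : SFL3) : CritSmoothingNoSwirlB :=
  critSmoothingNoSwirlB_of_regularity h

/-- **`(SFL³-mild) ⇒ CritSmoothingNoSwirlB`**: globality of the Kato solution for swirl-free
axisymmetric `L³` data already implies the critical modulus (`sfl3_of_sfl3Mild`, weak–strong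
uniqueness and Kato's bound, then (J)). -/
theorem critSmoothingNoSwirlB_of_sfl3Mild (h : SFL3Mild) : CritSmoothingNoSwirlB :=
  critSmoothingNoSwirlB_of_sfl3 (sfl3_of_sfl3Mild h)

/-- A global Kato solution (`HasGlobalKatoSolution`) yields ONE field which is a Kato solution on
every `[0, T)`: restrict to `[0, n)` for each `n` and glue by uniqueness
(`exists_isKatoSolutionOn_forall`, `kato_unique_holds`). -/
theorem exists_forall_isKatoSolutionOn_of_hasGlobalKatoSolution
    {u₀ : EuclideanSpace ℝ (Fin 3) → EuclideanSpace ℝ (Fin 3)} (h : HasGlobalKatoSolution 1 u₀) :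
    ∃ u : ℝ → EuclideanSpace ℝ (Fin 3) → EuclideanSpace ℝ (Fin 3),
      ∀ T : ℝ, 0 < T → IsKatoSolutionOn T 1 u₀ u := by
  have hn : ∀ n : ℕ, ∃ u, IsKatoSolutionOn (n : ℝ) 1 u₀ u := fun n => h.exists_isKatoSolutionOn n
  choose u hu using hn
  obtain ⟨v, hv⟩ := exists_isKatoSolutionOn_forall kato_unique_holds one_pos hu
  refine ⟨v, fun T _ => ?_⟩
  obtain ⟨n, hn⟩ := exists_nat_gt T
  exact (hv n).mono hn.le

/-- **The node `SFL3Mild` from its `T_max = ∞` phrasing**: if every weakly divergence-free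
`u₀ ∈ L³`, a.e. axisymmetric and swirl-free about a vertical axis, has a global Kato solution
(`HasGlobalKatoSolution 1 u₀`), then `SFL3Mild`. -/
theorem sfl3Mild_of_hasGlobalKatoSolution
    (h : ∀ (b : EuclideanSpace ℝ (Fin 3)) (u₀ : EuclideanSpace ℝ (Fin 3) → EuclideanSpace ℝ (Fin 3)),
      MemLp u₀ 3 volume → IsWeaklyDivFree u₀ →
      (∀ θ : ℝ, ∀ᵐ x ∂volume, u₀ (b + rotZ θ (x - b)) = rotZ θ (u₀ x)) →
      (∀ᵐ x ∂volume, (x - b) 0 * u₀ x 1 - (x - b) 1 * u₀ x 0 = 0) →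
      HasGlobalKatoSolution 1 u₀) :
    SFL3Mild := fun b u₀ hu₀ hdiv hax hsw =>
  exists_forall_isKatoSolutionOn_of_hasGlobalKatoSolution (h b u₀ hu₀ hdiv hax hsw)

/-- **`T_max = ∞` for swirl-free axisymmetric `L³` data ⇒ CritSmoothingNoSwirlB** (the chain in
the `HasGlobalKatoSolution` vocabulary). -/
theorem critSmoothingNoSwirlB_of_hasGlobalKatoSolution
    (h : ∀ (b : EuclideanSpace ℝ (Fin 3)) (u₀ : EuclideanSpace ℝ (Fin 3) → EuclideanSpace ℝ (Fin 3)),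
      MemLp u₀ 3 volume → IsWeaklyDivFree u₀ →
      (∀ θ : ℝ, ∀ᵐ x ∂volume, u₀ (b + rotZ θ (x - b)) = rotZ θ (u₀ x)) →
      (∀ᵐ x ∂volume, (x - b) 0 * u₀ x 1 - (x - b) 1 * u₀ x 0 = 0) →
      HasGlobalKatoSolution 1 u₀) :
    CritSmoothingNoSwirlB :=
  critSmoothingNoSwirlB_of_sfl3Mild (sfl3Mild_of_hasGlobalKatoSolution h)

/-- **(SFL³) ⇒ the velocity-indexed swirl-free jaw** (ROUND-12 §2c currency): there is
`Φ : ℝ → ℝ` such that along every Tao-class swirl-free axisymmetric solution (`ν = 1`) with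
`‖u₀‖₃ ≤ A` and energy level `∫|u(t)|² ≤ e` on `(0,T)`, for every `q ≥ 0`,
`∫₀ᵀ ‖u(t)‖₃^q dt ≤ Φ(A)^{q/3} e^{q/3} ∫₀ᵀ t^{-q/6} dt` (finite for `q < 6`,
`lintegral_Ioo_sqrtInv_rpow_lt_top`). -/
theorem lpTime_three_le_noSwirl_of_sfl3 (h : SFL3) :
    ∃ Φ : ℝ → ℝ, ∀ ⦃T A : ℝ⦄, 0 < T → 0 ≤ A →
      ∀ ⦃u₀ : E3 → E3⦄ ⦃u : ℝ → E3 → E3⦄ ⦃p : ℝ → E3 → ℝ⦄,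
        IsTaoSolutionOn T 1 u₀ u p → IsAxisymmetric u₀ → HasNoSwirl u₀ →
        eLpNorm u₀ 3 volume ≤ ENNReal.ofReal A →
        ∀ ⦃e : ℝ≥0∞⦄, e ≠ ⊤ → (∀ t ∈ Ioo 0 T, ∫⁻ x, ‖u t x‖ₑ ^ 2 ≤ e) →
        ∀ ⦃q : ℝ⦄, 0 ≤ q →
          lpTime 3 q T u ≤ ENNReal.ofReal (Φ A) ^ (q / 3) * e ^ (q / 3) *
            ∫⁻ t in Ioo 0 T, ENNReal.ofReal (t ^ (-(1 / 2 : ℝ))) ^ (q / 3) := by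
  obtain ⟨Φ, hΦ⟩ := critSmoothingNoSwirlB_of_sfl3 h
  exact ⟨Φ, fun T A hT hA u₀ u p hsol h0 h0' hA' e he hE q hq =>
    lpTime_three_le_noSwirl_of_critSmoothingNoSwirl hΦ hT hA hsol h0 h0' hA' he hE hq⟩

end Summit.NavierStokesRegularity.NavierStokesRegularity.Theorems.L3TimeExponentPincerCritModulusNoSwirlReductionSFL3

end
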